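import Summits.AnomalousDissipation.AnomalousDissipation.Theorems.SoloBlindStressIdentity

/-!
# Solo (blind) — Reynolds-stress pinning for a general steady force

Continuation of `SoloBlindStressIdentity`: `f : 𝕋³ → ℝ³` smooth with zero mean, `Ψ` smooth and
divergence-free with `ΔΨ = −λf`, `λ > 0`, `A(t) = ∫⟪u,(u·∇)Ψ⟫` the Reynolds-stress moment,
`Γ = ∫⟪f,Ψ⟫ = ‖∇Ψ‖²/λ`. Along EVERY global Leray–Hopf solution of `NS_ν(f)` with `ν > 0` (no
further hypothesis):

* `meanPower_eq_stress` (exact): `meanPower f u = (Γ + limsup_T ⟨A⟩_T)/(νλ)`;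
* `stress_unpinned_of_floor`: `ε ≤ meanDissipation ν u ⟹ νλε ≤ Γ + limsup_T ⟨A⟩_T`;
* `stress_longTimeAvg_bounds_of_meanEnergy`: `meanEnergy u ≤ E ⟹
  −Γ − νλ‖f‖√E ≤ liminf_T ⟨A⟩_T ≤ limsup_T ⟨A⟩_T ≤ −Γ + νλ‖f‖√E`;
* `floor_iff_stress_unpinned_of_meanEnergyEq` / `_of_memL4`: under the mean energy equality
  (automatic in Lions' class `L⁴ₜL⁴ₓ`) the floor is EQUIVALENT to the un-pinning;
* `zerothLaw_of_stress_unpinned_LH_family` / `_L4_family`: the doors to `ZerothLaw` for an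
  arbitrary admissible force;
* `meanPower_kolForce_eq_stress`: the Kolmogorov instance (`Ψ = f`, `λ = 4π²`, `Γ = ½`,
  `A = −2π ∫ u₁u₃ sin(2πx₃)`).

So for every force the zeroth law is the statement that the long-time Reynolds-stress working
against the force potential, pinned to `−Γ` with defect `O(ν_j)` along any bounded-energy family,
keeps a defect `≥ ν_j λ ε` from below: `ZerothLaw`'s floor lives entirely in the `O(ν)`-corrections
to an exactly pinned large-scale balance, for any choice of `f`.
[folklore; cite: DoeringFoias2002, §2; cite: Temam1984, Ch. III §1.1 (1.25)]
-/


open MeasureTheory Filter Topology Set UnitAddTorus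
open scoped ENNReal NNReal InnerProductSpace

noncomputable section

namespace Summit.AnomalousDissipation.AnomalousDissipation.Theorems

open Literature.Analysis.FunctionSpaces Literature.Analysis.FunctionSpaces.Torus
open Literature.Analysis.FluidPDE

variable {ν lam T : ℝ} {f Ψ u₀ : UnitAddTorus (Fin 3) → EuclideanSpace ℝ (Fin 3)}
  {u : ℝ → UnitAddTorus (Fin 3) → EuclideanSpace ℝ (Fin 3)}

/-! ### The exact formula for the mean power -/

/-- **The mean injected power is read off the Reynolds stress — exact, hypothesis-free.**
Along EVERY global Leray–Hopf weak solution of `NS_ν(f)` on `𝕋³` with `ν > 0` (`f` smooth with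
zero mean; `Ψ` smooth, divergence-free, `ΔΨ = −λf`, `λ > 0`):
`meanPower f u = (∫⟪f,Ψ⟫ + limsup_T ⟨∫⟪u,(u·∇)Ψ⟫⟩_T)/(νλ)`.
[folklore; cite: DoeringFoias2002, §2] -/
theorem meanPower_eq_stress (hu : Torus.IsGlobalLerayHopf ν (fun _ => f) u₀ u)
    (hν : 0 < ν) (hf : IsSmooth f) (hf0 : HasZeroMean f) (hΨ : IsSmooth Ψ)
    (hΨdiv : IsDivFree Ψ) (hlam : 0 < lam) (hΨf : ∀ x, Torus.laplacian Ψ x = -lam • f x) :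
    meanPower f u =
      ((∫ x, ⟪f x, Ψ x⟫_ℝ) + longTimeAvgSup (stressMoment Ψ u)) / (ν * lam) := by
  change limsup (forcePowerMean f u) atTop =
    ((∫ x, ⟪f x, Ψ x⟫_ℝ) + limsup (stressMean Ψ u) atTop) / (ν * lam)
  set Γ : ℝ := ∫ x, ⟪f x, Ψ x⟫_ℝ with hΓ
  have hνl : 0 < ν * lam := mul_pos hν hlam
  set φ : ℝ → ℝ := fun a => (Γ + a) / (ν * lam) with hφdef
  have hφ : Monotone φ := fun a b hab => div_le_div_of_nonneg_right (by linarith) hνl.le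
  have hφc : Continuous φ := (continuous_const.add continuous_id).div_const _
  obtain ⟨C, hC⟩ := eventually_stressMean_crude_bounds hu hν hf hf0 hΨ hΨdiv hlam hΨf
  have hbA : IsBoundedUnder (· ≤ ·) atTop (stressMean Ψ u) := by
    refine isBoundedUnder_of_eventually_le (a := -Γ + (ν * lam * C + 1)) ?_
    filter_upwards [hC] with T hT
    linarith [(abs_le.1 hT.2).2]
  have hbA' : IsBoundedUnder (· ≥ ·) atTop (stressMean Ψ u) := by
    refine isBoundedUnder_of_eventually_ge (a := -Γ - (ν * lam * C + 1)) ?_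
    filter_upwards [hC] with T hT
    linarith [(abs_le.1 hT.2).1]
  have hbφ : IsBoundedUnder (· ≤ ·) atTop (fun T => φ (stressMean Ψ u T)) := by
    obtain ⟨a, ha⟩ := hbA.eventually_le
    exact isBoundedUnder_of_eventually_le (ha.mono fun T h => hφ h)
  have hbφ' : IsBoundedUnder (· ≥ ·) atTop (fun T => φ (stressMean Ψ u T)) := by
    obtain ⟨a, ha⟩ := hbA'.eventually_ge
    exact isBoundedUnder_of_eventually_ge (ha.mono fun T h => hφ h)
  -- the remainder
  set r : ℝ → ℝ := fun T =>
    -(T⁻¹ * ((∫ x, ⟪u T x, Ψ x⟫_ℝ) - ∫ x, ⟪u₀ x, Ψ x⟫_ℝ)) / (ν * lam) with hrdef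
  have hr : Tendsto r atTop (𝓝 0) := by
    have h := ((tendsto_stressBoundary hu hν hf hf0 hΨ).neg).div_const (ν * lam)
    rwa [neg_zero, zero_div] at h
  have hdec : forcePowerMean f u =ᶠ[atTop] fun T => φ (stressMean Ψ u T) + r T := by
    filter_upwards [eventually_gt_atTop (0 : ℝ)] with T hT
    have e := stress_window_eq hu hf hΨ hΨdiv hΨf hT
    simp only [hφdef, hrdef]
    rw [← add_div, eq_div_iff hνl.ne']
    linarith
  rw [limsup_congr hdec]
  have h1 : limsup (fun T => φ (stressMean Ψ u T) + r T) atTop ≤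
      limsup (fun T => φ (stressMean Ψ u T)) atTop + limsup r atTop :=
    limsup_add_le hbφ' hbφ hr.isBoundedUnder_ge.isCoboundedUnder_le hr.isBoundedUnder_le
  have h2 : limsup (fun T => φ (stressMean Ψ u T)) atTop + liminf r atTop ≤
      limsup (fun T => φ (stressMean Ψ u T) + r T) atTop :=
    le_limsup_add hbφ hbφ'.isCoboundedUnder_le hr.isBoundedUnder_le hr.isBoundedUnder_ge
  rw [hr.limsup_eq, add_zero] at h1
  rw [hr.liminf_eq, add_zero] at h2
  rw [le_antisymm h1 h2]
  exact (hφ.map_limsup_of_continuousAt (stressMean Ψ u) hφc.continuousAt hbA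
    hbA'.isCoboundedUnder_le).symm

/-- **A dissipation floor un-pins the Reynolds stress** — under `ZerothLaw`'s hypotheses only:
`ε ≤ meanDissipation ν u ⟹ νλε ≤ ∫⟪f,Ψ⟫ + limsup_T ⟨A⟩_T` (the Leray–Hopf power balance
`meanDissipation ≤ meanPower`, `DoeringFoias2002_dissipation_le_power_holds`).
[folklore; cite: DoeringFoias2002, §2] -/
theorem stress_unpinned_of_floor (hu : Torus.IsGlobalLerayHopf ν (fun _ => f) u₀ u)
    (hν : 0 < ν) (hf : IsSmooth f) (hf0 : HasZeroMean f) (hΨ : IsSmooth Ψ)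
    (hΨdiv : IsDivFree Ψ) (hlam : 0 < lam) (hΨf : ∀ x, Torus.laplacian Ψ x = -lam • f x)
    {ε : ℝ} (hε : ε ≤ meanDissipation ν u) :
    ν * lam * ε ≤ (∫ x, ⟪f x, Ψ x⟫_ℝ) + longTimeAvgSup (stressMoment Ψ u) := by
  have hνl : 0 < ν * lam := mul_pos hν hlam
  have hP : ε ≤ meanPower f u :=
    hε.trans (DoeringFoias2002_dissipation_le_power_holds hν (hf.memLp 2) hf0 u₀ u hu)
  rw [meanPower_eq_stress hu hν hf hf0 hΨ hΨdiv hlam hΨf, le_div_iff₀ hνl] at hP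
  linarith

/-- Pinning from eventual two-sided control (bookkeeping): if for every `δ > 0` eventually
`|m(T) − c₀| ≤ c + δ`, then `c₀ − c ≤ liminf m` and `limsup m ≤ c₀ + c`. [folklore] -/
theorem liminf_limsup_bounds_of_eventually_abs_le {m : ℝ → ℝ} {c₀ c : ℝ}
    (hev : ∀ δ : ℝ, 0 < δ → ∀ᶠ T in atTop, |m T - c₀| ≤ c + δ) :
    c₀ - c ≤ liminf m atTop ∧ limsup m atTop ≤ c₀ + c := by
  have hlow : ∀ᶠ T in atTop, c₀ - c - 1 ≤ m T := by
    filter_upwards [hev 1 one_pos] with T hT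
    linarith [(abs_le.1 hT).1]
  have hup : ∀ᶠ T in atTop, m T ≤ c₀ + c + 1 := by
    filter_upwards [hev 1 one_pos] with T hT
    linarith [(abs_le.1 hT).2]
  constructor
  · refine le_of_forall_pos_le_add fun ε hε => ?_
    have hlim : c₀ - c - ε ≤ liminf m atTop := by
      refine le_liminf_of_le (isCoboundedUnder_ge_of_eventually_le atTop hup) ?_
      filter_upwards [hev ε hε] with T hT
      linarith [(abs_le.1 hT).1]
    linarith
  · refine le_of_forall_pos_le_add fun ε hε => ?_
    refine limsup_le_of_le (isCoboundedUnder_le_of_eventually_le atTop hlow) ?_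
    filter_upwards [hev ε hε] with T hT
    linarith [(abs_le.1 hT).2]

/-- **Pinning from the `limsup` Cesàro energy bound of `ZerothLaw`.** Along every global
Leray–Hopf weak solution of `NS_ν(f)` on `𝕋³` with `ν > 0` (`Ψ`, `λ` as above):
`meanEnergy u ≤ E ⟹ −∫⟪f,Ψ⟫ − νλ‖f‖_{L²}√E ≤ liminf_T ⟨A⟩_T` and
`limsup_T ⟨A⟩_T ≤ −∫⟪f,Ψ⟫ + νλ‖f‖_{L²}√E`: the long-time Reynolds-stress working against the force
potential is `−Γ + O(ν√E)`. [folklore; cite: DoeringFoias2002, §2] -/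
theorem stress_longTimeAvg_bounds_of_meanEnergy
    (hu : Torus.IsGlobalLerayHopf ν (fun _ => f) u₀ u)
    (hν : 0 < ν) (hf : IsSmooth f) (hf0 : HasZeroMean f) (hΨ : IsSmooth Ψ)
    (hΨdiv : IsDivFree Ψ) (hlam : 0 < lam) (hΨf : ∀ x, Torus.laplacian Ψ x = -lam • f x)
    {E : ℝ} (hE : meanEnergy u ≤ E) :
    -(∫ x, ⟪f x, Ψ x⟫_ℝ) - ν * lam * (Real.sqrt (∫ x, ‖f x‖ ^ 2) * Real.sqrt E) ≤
        longTimeAvgInf (stressMoment Ψ u) ∧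
      longTimeAvgSup (stressMoment Ψ u) ≤
        -(∫ x, ⟪f x, Ψ x⟫_ℝ) + ν * lam * (Real.sqrt (∫ x, ‖f x‖ ^ 2) * Real.sqrt E) := by
  change -(∫ x, ⟪f x, Ψ x⟫_ℝ) - ν * lam * (Real.sqrt (∫ x, ‖f x‖ ^ 2) * Real.sqrt E) ≤
        liminf (stressMean Ψ u) atTop ∧
      limsup (stressMean Ψ u) atTop ≤
        -(∫ x, ⟪f x, Ψ x⟫_ℝ) + ν * lam * (Real.sqrt (∫ x, ‖f x‖ ^ 2) * Real.sqrt E)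
  change limsup (energyMean u) atTop ≤ E at hE
  set Γ : ℝ := ∫ x, ⟪f x, Ψ x⟫_ℝ with hΓ
  set Fn : ℝ := Real.sqrt (∫ x, ‖f x‖ ^ 2) with hFn
  have hFn0 : 0 ≤ Fn := Real.sqrt_nonneg _
  have hνl : 0 < ν * lam := mul_pos hν hlam
  obtain ⟨K, hK0, hK⟩ := exists_energyMean_le_general hu hν hf hf0
  have hbddE : IsBoundedUnder (· ≤ ·) atTop (energyMean u) :=
    isBoundedUnder_of_eventually_le ((eventually_ge_atTop (1 : ℝ)).mono hK)
  have hE0 : 0 ≤ E := by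
    refine le_trans (le_limsup_of_frequently_le (Eventually.frequently ?_) hbddE) hE
    filter_upwards [eventually_ge_atTop (0 : ℝ)] with T hT
    exact mul_nonneg (inv_nonneg.2 hT) (intervalIntegral.integral_nonneg hT fun t _ =>
      integral_nonneg fun _ => by positivity)
  refine liminf_limsup_bounds_of_eventually_abs_le fun δ hδ => ?_
  set L : ℝ := ν * lam * Fn with hL
  have hL0 : 0 ≤ L := by positivity
  obtain ⟨η, hη0, hη⟩ : ∃ η : ℝ, 0 < η ∧ L * η ≤ δ / 2 :=
    ⟨δ / 2 / (L + 1), by positivity, by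
      calc L * (δ / 2 / (L + 1)) ≤ (L + 1) * (δ / 2 / (L + 1)) :=
            mul_le_mul_of_nonneg_right (by linarith) (by positivity)
        _ = δ / 2 := mul_div_cancel₀ _ (by positivity)⟩
  have hsqrt : ∀ᶠ T in atTop, Real.sqrt (energyMean u T) ≤ Real.sqrt E + η := by
    have hlt : limsup (energyMean u) atTop < (Real.sqrt E + η) ^ 2 := by
      have h : E < (Real.sqrt E + η) ^ 2 := by
        nlinarith [Real.sq_sqrt hE0, Real.sqrt_nonneg E]
      exact hE.trans_lt h
    filter_upwards [eventually_lt_of_limsup_lt hlt hbddE] with T hT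
    calc Real.sqrt (energyMean u T) ≤ Real.sqrt ((Real.sqrt E + η) ^ 2) :=
          Real.sqrt_le_sqrt hT.le
      _ = Real.sqrt E + η := Real.sqrt_sq (by positivity)
  filter_upwards [hsqrt, eventually_abs_stressBoundary_le hu hν hf hf0 hΨ (half_pos hδ),
    eventually_gt_atTop (0 : ℝ)] with T h1 h2 hT
  have e := stress_window_eq hu hf hΨ hΨdiv hΨf hT
  obtain ⟨p1, p2⟩ := abs_le.1 (abs_forcePowerMean_le hu hf hT)
  obtain ⟨b1, b2⟩ := abs_le.1 h2
  have q1 := mul_le_mul_of_nonneg_left p1 hνl.le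
  have q2 := mul_le_mul_of_nonneg_left p2 hνl.le
  have q : ν * lam * (Fn * Real.sqrt (energyMean u T)) ≤ L * Real.sqrt E + δ / 2 := by
    calc ν * lam * (Fn * Real.sqrt (energyMean u T))
        = L * Real.sqrt (energyMean u T) := by rw [hL]; ring
      _ ≤ L * (Real.sqrt E + η) := mul_le_mul_of_nonneg_left h1 hL0
      _ ≤ L * Real.sqrt E + δ / 2 := by rw [mul_add]; linarith
  have hLE : ν * lam * (Fn * Real.sqrt E) = L * Real.sqrt E := by rw [hL]; ring
  rw [abs_le]
  constructor <;> linarith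

/-- **`ZerothLaw`'s clauses pin the Reynolds stress into an `O(ν)` window.** For every global
Leray–Hopf weak solution of `NS_ν(f)` on `𝕋³` (`ν > 0`) satisfying `meanEnergy u ≤ E` and
`ε ≤ meanDissipation ν u`:
`−∫⟪f,Ψ⟫ + νλε ≤ limsup_T ⟨∫⟪u,(u·∇)Ψ⟫⟩_T ≤ −∫⟪f,Ψ⟫ + νλ‖f‖_{L²}√E`. [folklore] -/
theorem zerothLaw_clauses_pin_stress (hu : Torus.IsGlobalLerayHopf ν (fun _ => f) u₀ u)
    (hν : 0 < ν) (hf : IsSmooth f) (hf0 : HasZeroMean f) (hΨ : IsSmooth Ψ)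
    (hΨdiv : IsDivFree Ψ) (hlam : 0 < lam) (hΨf : ∀ x, Torus.laplacian Ψ x = -lam • f x)
    {E ε : ℝ} (hE : meanEnergy u ≤ E) (hε : ε ≤ meanDissipation ν u) :
    -(∫ x, ⟪f x, Ψ x⟫_ℝ) + ν * lam * ε ≤ longTimeAvgSup (stressMoment Ψ u) ∧
      longTimeAvgSup (stressMoment Ψ u) ≤
        -(∫ x, ⟪f x, Ψ x⟫_ℝ) + ν * lam * (Real.sqrt (∫ x, ‖f x‖ ^ 2) * Real.sqrt E) :=
  ⟨by linarith [stress_unpinned_of_floor hu hν hf hf0 hΨ hΨdiv hlam hΨf hε],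
    (stress_longTimeAvg_bounds_of_meanEnergy hu hν hf hf0 hΨ hΨdiv hlam hΨf hE).2⟩

/-! ### Floor ⟺ un-pinning, and the doors to `ZerothLaw` -/

/-- **Floor ⟺ un-pinning of the Reynolds stress, at Leray–Hopf level.** For a global
Leray–Hopf solution of `NS_ν(f)` on `𝕋³` (`ν > 0`) with mean energy equality
`meanPower f u ≤ meanDissipation ν u` (the reverse inequality is automatic), and every `ε`:
`ε ≤ meanDissipation ν u ↔ νλε ≤ ∫⟪f,Ψ⟫ + limsup_T ⟨∫⟪u,(u·∇)Ψ⟫⟩_T`. [folklore] -/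
theorem floor_iff_stress_unpinned_of_meanEnergyEq
    (hu : Torus.IsGlobalLerayHopf ν (fun _ => f) u₀ u)
    (hν : 0 < ν) (hf : IsSmooth f) (hf0 : HasZeroMean f) (hΨ : IsSmooth Ψ)
    (hΨdiv : IsDivFree Ψ) (hlam : 0 < lam) (hΨf : ∀ x, Torus.laplacian Ψ x = -lam • f x)
    (hEE : meanPower f u ≤ meanDissipation ν u) (ε : ℝ) :
    ε ≤ meanDissipation ν u ↔
      ν * lam * ε ≤ (∫ x, ⟪f x, Ψ x⟫_ℝ) + longTimeAvgSup (stressMoment Ψ u) := by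
  refine ⟨stress_unpinned_of_floor hu hν hf hf0 hΨ hΨdiv hlam hΨf, fun hA => le_trans ?_ hEE⟩
  have hνl : 0 < ν * lam := mul_pos hν hlam
  rw [meanPower_eq_stress hu hν hf hf0 hΨ hΨdiv hlam hΨf, le_div_iff₀ hνl]
  linarith

/-- **Floor ⟺ un-pinning in Lions' class**: the same equivalence for a global Leray–Hopf
solution of `NS_ν(f)` (`ν > 0`, `L²` datum) with `u ∈ L⁴(0,T; L⁴(𝕋³))` for every `T`.
[folklore; cite: Shinbrot1974, Thm.] -/
theorem floor_iff_stress_unpinned_of_memL4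
    (hu : Torus.IsGlobalLerayHopf ν (fun _ => f) u₀ u)
    (hν : 0 < ν) (hf : IsSmooth f) (hf0 : HasZeroMean f) (hΨ : IsSmooth Ψ)
    (hΨdiv : IsDivFree Ψ) (hlam : 0 < lam) (hΨf : ∀ x, Torus.laplacian Ψ x = -lam • f x)
    (hu₀ : MemLp u₀ 2 volume) (hL4 : ∀ T, 0 < T → Torus.MemLqLp 4 4 u (Ioo 0 T)) (ε : ℝ) :
    ε ≤ meanDissipation ν u ↔
      ν * lam * ε ≤ (∫ x, ⟪f x, Ψ x⟫_ℝ) + longTimeAvgSup (stressMoment Ψ u) :=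
  floor_iff_stress_unpinned_of_meanEnergyEq hu hν hf hf0 hΨ hΨdiv hlam hΨf
    (lh_meanPower_eq_meanDissipation_of_memL4 hu hν hf hf0 hu₀ hL4).le ε

/-- **The Reynolds-stress door to `ZerothLaw`, Leray–Hopf level, arbitrary force.** `ZerothLaw`
follows from: a smooth divergence-free zero-mean force `f` on `𝕋³` with a potential `Ψ` (smooth,
divergence-free, `ΔΨ = −λf`, `λ > 0`); positive viscosities `ν_j → 0`; global Leray–Hopf solutions
`u_j` of `NS_{ν_j}(f)` with mean energies `≤ E` and mean energy equality
`meanPower f u_j ≤ meanDissipation ν_j u_j`; and, for one `ε > 0` and all `j`, the un-pinning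
`ν_j λ ε ≤ ∫⟪f,Ψ⟫ + limsup_T ⟨∫⟪u_j,(u_j·∇)Ψ⟫⟩_T`. [folklore] -/
theorem zerothLaw_of_stress_unpinned_LH_family (hf : IsSmooth f) (hfdiv : IsDivFree f)
    (hf0 : HasZeroMean f) (hΨ : IsSmooth Ψ) (hΨdiv : IsDivFree Ψ) (hlam : 0 < lam)
    (hΨf : ∀ x, Torus.laplacian Ψ x = -lam • f x) {νs : ℕ → ℝ}
    {u₀s : ℕ → UnitAddTorus (Fin 3) → EuclideanSpace ℝ (Fin 3)}
    {us : ℕ → ℝ → UnitAddTorus (Fin 3) → EuclideanSpace ℝ (Fin 3)}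
    (hν : ∀ j, 0 < νs j) (hν0 : Tendsto νs atTop (𝓝 0))
    (hlh : ∀ j, Torus.IsGlobalLerayHopf (νs j) (fun _ => f) (u₀s j) (us j))
    (hE : ∃ E : ℝ, ∀ j, meanEnergy (us j) ≤ E)
    (hEE : ∀ j, meanPower f (us j) ≤ meanDissipation (νs j) (us j))
    {ε : ℝ} (hε : 0 < ε)
    (hA : ∀ j, νs j * lam * ε ≤ (∫ x, ⟪f x, Ψ x⟫_ℝ) + longTimeAvgSup (stressMoment Ψ (us j))) :
    Literature.Turb.ZerothLaw :=
  ⟨f, hf, hfdiv, hf0, νs, u₀s, us, hν, hν0, hlh, hE, ε, hε, fun j =>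
    (floor_iff_stress_unpinned_of_meanEnergyEq (hlh j) (hν j) hf hf0 hΨ hΨdiv hlam hΨf
      (hEE j) ε).2 (hA j)⟩

/-- **The Reynolds-stress door to `ZerothLaw`, Lions class, arbitrary force.** As
`zerothLaw_of_stress_unpinned_LH_family`, with the mean energy equality replaced by `L²` data and
`u_j ∈ L⁴(0,T; L⁴(𝕋³))` for every `T` (Lions–Shinbrot). On this class the un-pinning clause is
EQUIVALENT to the dissipation floor (`floor_iff_stress_unpinned_of_memL4`).
[folklore; cite: Shinbrot1974, Thm.; cite: DoeringFoias2002, §2] -/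
theorem zerothLaw_of_stress_unpinned_L4_family (hf : IsSmooth f) (hfdiv : IsDivFree f)
    (hf0 : HasZeroMean f) (hΨ : IsSmooth Ψ) (hΨdiv : IsDivFree Ψ) (hlam : 0 < lam)
    (hΨf : ∀ x, Torus.laplacian Ψ x = -lam • f x) {νs : ℕ → ℝ}
    {u₀s : ℕ → UnitAddTorus (Fin 3) → EuclideanSpace ℝ (Fin 3)}
    {us : ℕ → ℝ → UnitAddTorus (Fin 3) → EuclideanSpace ℝ (Fin 3)}
    (hν : ∀ j, 0 < νs j) (hν0 : Tendsto νs atTop (𝓝 0))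
    (hlh : ∀ j, Torus.IsGlobalLerayHopf (νs j) (fun _ => f) (u₀s j) (us j))
    (hu₀ : ∀ j, MemLp (u₀s j) 2 volume)
    (hL4 : ∀ j T, 0 < T → Torus.MemLqLp 4 4 (us j) (Ioo 0 T))
    (hE : ∃ E : ℝ, ∀ j, meanEnergy (us j) ≤ E) {ε : ℝ} (hε : 0 < ε)
    (hA : ∀ j, νs j * lam * ε ≤ (∫ x, ⟪f x, Ψ x⟫_ℝ) + longTimeAvgSup (stressMoment Ψ (us j))) :
    Literature.Turb.ZerothLaw :=
  zerothLaw_of_stress_unpinned_LH_family hf hfdiv hf0 hΨ hΨdiv hlam hΨf hν hν0 hlh hE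
    (fun j => (lh_meanPower_eq_meanDissipation_of_memL4 (hlh j) (hν j) hf hf0 (hu₀ j)
      (hL4 j)).le) hε hA

/-! ### The Kolmogorov instance -/

/-- For the Kolmogorov force the Reynolds-stress moment against `Ψ = f` is `−2π` times the
in-phase flux moment: `∫⟪u,(u·∇)f⟫ = −2π ∫ u₃⟪sin(2πx₃)e₁, u⟫`. [folklore] -/
theorem stressMoment_kolForce_eq (u : ℝ → UnitAddTorus (Fin 3) → EuclideanSpace ℝ (Fin 3))
    (t : ℝ) :
    stressMoment kolForce u t = -(2 * Real.pi) * ∫ x, u t x 2 * ⟪kolSin x, u t x⟫_ℝ :=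
  integral_inner_convect_kolForce (u t)

/-- **Kolmogorov instance** (`Ψ = f = cos(2πx₃)e₁`, `λ = 4π²`, `∫⟪f,f⟫ = ½`): along every global
Leray–Hopf solution of the Kolmogorov-forced system with `ν > 0`,
`meanPower f u = (½ + limsup_T ⟨∫⟪u,(u·∇)f⟫⟩_T)/(4π²ν)`. [folklore] -/
theorem meanPower_kolForce_eq_stress
    (hu : Torus.IsGlobalLerayHopf ν (fun _ => kolForce) u₀ u) (hν : 0 < ν) :
    meanPower kolForce u =
      (1 / 2 + longTimeAvgSup (stressMoment kolForce u)) / (ν * (4 * Real.pi ^ 2)) := by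
  rw [← integral_inner_kolForce_self]
  exact meanPower_eq_stress hu hν isSmooth_kolForce hasZeroMean_kolForce isSmooth_kolForce
    isDivFree_kolForce (by positivity) laplacian_kolForce

end Summit.AnomalousDissipation.AnomalousDissipation.Theorems

end
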